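import Literature.IUT.HodgeArakelov.EtaleThetaDataOfSettingCuspidalGenerators
import Literature.IUT.HodgeArakelov.LabelClassesOfCuspsCor24iiProofs
import HarnessLib

/-!
# [IUTchII] Cor. 2.5 (i), residual J1 AT THE §1–§2 FRAME: for the genuine Prop. 1.4 output and ANY
# `TemperedCoverings` / `PlusMinusTower` / `CuspidalInertiaData` over it, the consumer's `hgen` ⟺ the
# cusp-image clause (proof-only, 0 definitions)

S. Mochizuki, *Inter-universal Teichmüller theory II*, kurims manuscript (Dec. 2020), §2, Cor. 2.5 (i) p. 71,
proof p. 72 l. 35–38 («by considering the cuspidal inertia groups involved»); Def. 2.3 (i)(ii) pp. 67–68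
[claim: Mochizuki2012, status: disputed] (IUTchII §2 Cor 2.5 (i), kurims p.71) [cite: MochizukiEtTh2009, §1 p.12].
abc-iut cell, layer L6, node **IUTchII:Cor2.5(i)**, residual J1 = GAP-LEDGER G-w4d005g4-1; seat abc-iut-w4-d024
(gen 5). Sequel to `EtaleThetaDataOfSettingCuspidalGenerators.lean` (p434999): there the equivalence
«`hgen` ⟺ clause» is stated for an abstract injective push-forward `ε : Π^tp_{X̲̲} ↪ Q` and an abstract family
`J` of subgroups of `ε(Π^tp_{X̲̲})`. HERE it is stated in the EXACT vocabulary of the GAP row — abc-iut-L6-t1's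
`TemperedCoverings S Π` / `PlusMinusTower T` / `CuspidalInertiaData W` (`LabelClassesOfCusps.lean`, p407174) over
the genuine `Π := Π^tp_{X̲̲}`, with `ε := W.emb.comp T.incl : Π_v ↪ Π̂^cor_v` (injective:
`PlusMinusTower.emb_comp_incl_injective`, `LabelClassesOfCuspsCor24iiProofs.lean` p413817) and `J :=` the family
`{I // C.IsCuspidalInertia W.piV I}` of cuspidal inertia groups of `Π_v = W.piV` (each `≤ W.piV = range ε` by
`le_of_isCuspidalInertia`):

* **`etaleThetaDataOfSetting'_hgen_frame_iff`** — the GAP row's wanted identity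
  `(D.lDeltaTheta.top).map (W.emb.comp T.incl) = (D.lDeltaTheta.bot).map (W.emb.comp T.incl) ⊔ ⨆ I, ↑I` for
  `D :=` the genuine bridge `etaleThetaDataOfSetting' …` holds IF AND ONLY IF the `θ`-images
  `φ((W.emb.comp T.incl)⁻¹ I)` of the cuspidal inertia groups of `Π_v`, pulled back to `Π^tp_{X̲̲}`, lie in and
  generate `l·Δ_Θ`;
* **`etaleThetaDataOfSetting'_cor25i_frame`** — under that clause, Cor. 2.5 (i)'s conclusion
  `((top).map ε ⊓ H) ⊔ (bot).map ε = (top).map ε` for every `H ≤ Π̂^cor_v` containing the cuspidal inertia groups of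
  `Π_v` (the consumer's `Π_{v⩒▶}`, Cor. 2.4 (ii)), i.e. abc-iut-w4-d005's p431116 conclusion with NO `hgen` binder
  beyond the clause.

HONEST LIMITS: `T`, `W`, `C` are ARBITRARY interface data over the genuine `Π` (the theorem quantifies over them;
no genuine tower is singled out); the clause is a hypothesis / one side of an iff, not proved — it is the §1
cusp-position junction (G-L2t10-3 family); no new `def`, no new `Prop` fact; nothing of [EtTh] or of the
series is asserted; no side is taken on [IUTchIII] Cor. 3.12; typed ≠ proved.
-/

noncomputable section

namespace Literature.IUT.HodgeArakelov

namespace EtaleThetaDataOfSetting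

variable {p : ℕ} [Fact p.Prime] {D : Literature.AnabelianGeometry.EtaleTheta.ThetaSetting p}
  {E : D.EtaleThetaData} {l : ℕ} (C : E.DoubleUnderline l)
  {S : BadPlaceSetting.{0}} (T : TemperedCoverings S (Pi C)) (W : PlusMinusTower T)
  (Cu : CuspidalInertiaData W)

/-- **Residual J1 at the [IUTchII] §1–§2 frame over the genuine `Π^tp_{X̲̲}` — kernel IFF.** For the genuine
Prop. 1.4 output `D := etaleThetaDataOfSetting' …` and ANY `T : TemperedCoverings S Π`, `W : PlusMinusTower T`,
`Cu : CuspidalInertiaData W`: the hypothesis `hgen` of p431116 in the GAP row's exact shape,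
`(D.lDeltaTheta.top).map (W.emb.comp T.incl) = (D.lDeltaTheta.bot).map (W.emb.comp T.incl) ⊔ ⨆ I, ↑I`
(`I` over the cuspidal inertia groups of `Π_v = W.piV`), holds IFF the `θ`-images of the pulled-back cuspidal
inertia groups lie in and generate `l·Δ_Θ`.
[claim: Mochizuki2012, status: disputed] (IUTchII §2 Cor 2.5 (i), kurims p.71) -/
theorem etaleThetaDataOfSetting'_hgen_frame_iff (hC : D.Compat) (hS : D.Sec2Hyps)
    (hchar : PiYddCharacteristic C) (eS : (Pi C) ≃ₜ* S.PiX) (hl : S.l = l) :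
    ((etaleThetaDataOfSetting' C hC hS hchar S.toThetaSetting eS hl).lDeltaTheta.top).map (W.emb.comp T.incl) =
        ((etaleThetaDataOfSetting' C hC hS hchar S.toThetaSetting eS hl).lDeltaTheta.bot).map
            (W.emb.comp T.incl) ⊔
          ⨆ I : {I // Cu.IsCuspidalInertia W.piV I}, (I : Subgroup W.Corhat) ↔
      (∀ I : {I // Cu.IsCuspidalInertia W.piV I},
          ((I.1.comap (W.emb.comp T.incl)).map (phi C)) ≤ D.lDeltaTheta l) ∧
        D.lDeltaTheta l ≤
          ⨆ I : {I // Cu.IsCuspidalInertia W.piV I}, (I.1.comap (W.emb.comp T.incl)).map (phi C) :=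
  etaleThetaDataOfSetting'_hgen_iff_comap C hC hS hchar S.toThetaSetting eS hl (W.emb.comp T.incl)
    W.emb_comp_incl_injective (fun I : {I // Cu.IsCuspidalInertia W.piV I} => (I : Subgroup W.Corhat))
    (fun I => Cu.le_of_isCuspidalInertia I.2)

/-- **IUTchII:Cor2.5(i) at the frame over the genuine `Π^tp_{X̲̲}`, from the clause alone**: if the `θ`-images of
the pulled-back cuspidal inertia groups of `Π_v` lie in and generate `l·Δ_Θ`, then for every `H ≤ Π̂^cor_v`
containing those cuspidal inertia groups (the consumer's `Π_{v⩒▶}`; Cor. 2.4 (ii) «`I^δ_t ⊆ Π^δ_{v⩒▶}`»),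
`((top).map ε ⊓ H) ⊔ (bot).map ε = (top).map ε` with `ε = W.emb ∘ T.incl` — «the inclusion `Π_{v⩒▶} ↪ Π_v` induces
an isomorphism `(l·Δ_Θ)(Π_{v⩒▶}) ⥲ (l·Δ_Θ)(Π_v)`» (p431116's conclusion), the binder `hgen` DISCHARGED from the
clause. [claim: Mochizuki2012, status: disputed] (IUTchII §2 Cor 2.5 (i), kurims p.71) -/
theorem etaleThetaDataOfSetting'_cor25i_frame (hC : D.Compat) (hS : D.Sec2Hyps)
    (hchar : PiYddCharacteristic C) (eS : (Pi C) ≃ₜ* S.PiX) (hl : S.l = l)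
    (hle : ∀ I : {I // Cu.IsCuspidalInertia W.piV I},
      ((I.1.comap (W.emb.comp T.incl)).map (phi C)) ≤ D.lDeltaTheta l)
    (hgen : D.lDeltaTheta l ≤
      ⨆ I : {I // Cu.IsCuspidalInertia W.piV I}, (I.1.comap (W.emb.comp T.incl)).map (phi C))
    (H : Subgroup W.Corhat) (hH : ∀ I, Cu.IsCuspidalInertia W.piV I → I ≤ H) :
    (((etaleThetaDataOfSetting' C hC hS hchar S.toThetaSetting eS hl).lDeltaTheta.top).map
            (W.emb.comp T.incl) ⊓ H) ⊔
        ((etaleThetaDataOfSetting' C hC hS hchar S.toThetaSetting eS hl).lDeltaTheta.bot).map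
          (W.emb.comp T.incl) =
      ((etaleThetaDataOfSetting' C hC hS hchar S.toThetaSetting eS hl).lDeltaTheta.top).map
        (W.emb.comp T.incl) := by
  have hIJ : ∀ I : {I // Cu.IsCuspidalInertia W.piV I},
      (I.1.comap (W.emb.comp T.incl)).map (W.emb.comp T.incl) = (I : Subgroup W.Corhat) := fun I => by
    rw [Subgroup.map_comap_eq, inf_eq_right.2 (Cu.le_of_isCuspidalInertia I.2)]
  exact etaleThetaDataOfSetting'_cor25i C hC hS hchar S.toThetaSetting eS hl (W.emb.comp T.incl)
    (fun I : {I // Cu.IsCuspidalInertia W.piV I} => I.1.comap (W.emb.comp T.incl))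
    (fun I => (I : Subgroup W.Corhat)) hIJ hle hgen H (fun I => hH I.1 I.2)

end EtaleThetaDataOfSetting

end Literature.IUT.HodgeArakelov

end
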